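import Mathlib
import Summits.AtomisticToContinuum.Crystallization.Theses.PhononSlackCertificates
import Summits.AtomisticToContinuum.Crystallization.Theorems.PhononSlackCertificatesNearFarGlueRReductionTight
import Literature.MathematicalPhysics.StatisticalMechanics.LennardJonesClusters
import Literature.Geometry.DiscreteGeometry.TwoShellPatterns

/-!
# Crux `PhononSlackCertificates.NearFarGlueR` (stmt-AtomisticToContinuum-14970), line `Sketch`:
the residual is radius-robust

Continuation lead c1.  The line's residual was filed at two contact radii by lead 0 — `ContactGap`
at radius `3` (`nearFarGlueR_of_contactGap`, Reduction, p102346) and the TIGHT contact gap at the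
first-neighbour radius `21/20` (`stub_tightContactGap`, ReductionTight, p103560).  This file shows
that ALL contact radii `r ≥ 21/20` give the SAME statement, unconditionally:

* `card_bad_near_good_le_tight` — in a `δ`-separated configuration the bad particles within `r` of a
  good particle number at most `((2r/δ+1)³ + 1)·#T`, `T` = tight contacts (nearest good particle,
  one step of the landed `stub_descentTight` with the sharp covers, and the packing count `stub_fibre`);
* `contactGapAt_iff_tightContactGap (hr : 21/20 ≤ r)` — contact gap at radius `r` ↔ tight contact gap
  (monotonicity of the charged population one way, the count the other way);
* `stub_radiusRobust` — the same for all `r` at once (registered sub-goal of the crux item).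

So the planner may promote the residual at any radius `≥ 21/20`; `21/20` is the weakest-looking
member of an equivalent family.  The statements are written out verbatim (no new definition).
-/

noncomputable section

namespace Summit.AtomisticToContinuum.Crystallization.Theorems.PhononSlackCertificatesNearFarGlueR

open Literature.MathematicalPhysics.StatisticalMechanics
open Literature.Geometry.DiscreteGeometry
open Summit.AtomisticToContinuum.Crystallization.Theses.PhononSlackCertificates
open scoped BigOperators RealInnerProductSpace

/-- **Counting bad particles near good ones against tight contacts.**  In a `δ`-separated
configuration, for every radius `r ≥ 21/20`, the bad particles lying within `r` of a good particle
number at most `((2r/δ + 1)³ + 1)` times the TIGHT contacts (bad particles within `21/20` of a good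
particle): from the nearest good particle one step of `stub_descentTight` lands on a tight contact
strictly closer, and `stub_fibre` counts the fibres. [folklore] -/
theorem card_bad_near_good_le_tight {δ r : ℝ} (hδ : 0 < δ) (hr : 21 / 20 ≤ r) {N : ℕ}
    (x : Fin N → EuclideanSpace ℝ (Fin 3)) (hsep : ∀ i j : Fin N, i ≠ j → δ ≤ dist (x i) (x j)) :
    (Nat.card {j : Fin N // ¬ IsTwoShellGood (1 / 20) (47 / 50) 1 x j ∧
        ∃ i : Fin N, IsTwoShellGood (1 / 20) (47 / 50) 1 x i ∧ dist (x i) (x j) ≤ r} : ℝ) ≤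
      ((2 * r / δ + 1) ^ 3 + 1) *
        (Nat.card {j : Fin N // ¬ IsTwoShellGood (1 / 20) (47 / 50) 1 x j ∧
          ∃ i : Fin N, IsTwoShellGood (1 / 20) (47 / 50) 1 x i ∧ dist (x i) (x j) ≤ 21 / 20} : ℝ) := by
  classical
  have hdesc := stub_descentTight stub_coverFccSharp stub_coverHcpSharp
  -- finsets for the two populations and the good particles
  set Br := Finset.univ.filter (fun j : Fin N => ¬ IsTwoShellGood (1 / 20) (47 / 50) 1 x j ∧
      ∃ i : Fin N, IsTwoShellGood (1 / 20) (47 / 50) 1 x i ∧ dist (x i) (x j) ≤ r) with hBr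
  set T := Finset.univ.filter (fun j : Fin N => ¬ IsTwoShellGood (1 / 20) (47 / 50) 1 x j ∧
      ∃ i : Fin N, IsTwoShellGood (1 / 20) (47 / 50) 1 x i ∧ dist (x i) (x j) ≤ 21 / 20) with hT
  set G := Finset.univ.filter (fun i : Fin N => IsTwoShellGood (1 / 20) (47 / 50) 1 x i) with hG
  have hmemBr : ∀ j, j ∈ Br ↔ (¬ IsTwoShellGood (1 / 20) (47 / 50) 1 x j ∧
      ∃ i : Fin N, IsTwoShellGood (1 / 20) (47 / 50) 1 x i ∧ dist (x i) (x j) ≤ r) := fun j => by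
    rw [hBr]; simp
  have hmemT : ∀ j, j ∈ T ↔ (¬ IsTwoShellGood (1 / 20) (47 / 50) 1 x j ∧
      ∃ i : Fin N, IsTwoShellGood (1 / 20) (47 / 50) 1 x i ∧ dist (x i) (x j) ≤ 21 / 20) := fun j => by
    rw [hT]; simp
  have hmemG : ∀ i, i ∈ G ↔ IsTwoShellGood (1 / 20) (47 / 50) 1 x i := fun i => by
    rw [hG]; simp
  have hcardBr : (Nat.card {j : Fin N // ¬ IsTwoShellGood (1 / 20) (47 / 50) 1 x j ∧
      ∃ i : Fin N, IsTwoShellGood (1 / 20) (47 / 50) 1 x i ∧ dist (x i) (x j) ≤ r} : ℝ) = Br.card := by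
    have e : {j : Fin N // ¬ IsTwoShellGood (1 / 20) (47 / 50) 1 x j ∧
        ∃ i : Fin N, IsTwoShellGood (1 / 20) (47 / 50) 1 x i ∧ dist (x i) (x j) ≤ r} ≃
        {j : Fin N // j ∈ Br} :=
      Equiv.subtypeEquivRight fun j => (hmemBr j).symm
    rw [Nat.card_congr e, Nat.card_eq_fintype_card, Fintype.card_coe]
  have hcardT : (Nat.card {j : Fin N // ¬ IsTwoShellGood (1 / 20) (47 / 50) 1 x j ∧
      ∃ i : Fin N, IsTwoShellGood (1 / 20) (47 / 50) 1 x i ∧ dist (x i) (x j) ≤ 21 / 20} : ℝ) =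
      T.card := by
    have e : {j : Fin N // ¬ IsTwoShellGood (1 / 20) (47 / 50) 1 x j ∧
        ∃ i : Fin N, IsTwoShellGood (1 / 20) (47 / 50) 1 x i ∧ dist (x i) (x j) ≤ 21 / 20} ≃
        {j : Fin N // j ∈ T} :=
      Equiv.subtypeEquivRight fun j => (hmemT j).symm
    rw [Nat.card_congr e, Nat.card_eq_fintype_card, Fintype.card_coe]
  rw [hcardBr, hcardT]
  have hr0 : 0 ≤ r := by linarith
  -- the fibre count on `Br \\ T`
  have hfib : ((Br \ T).card : ℝ) ≤ (2 * r / δ + 1) ^ 3 * (T.card : ℝ) := by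
    refine stub_fibre δ r hδ hr0 N x hsep (Br \ T) T fun j hj => ?_
    obtain ⟨hjBr, hjT⟩ := Finset.mem_sdiff.1 hj
    obtain ⟨hjbad, i', hi'good, hi'd⟩ := (hmemBr j).1 hjBr
    have hGne : G.Nonempty := ⟨i', (hmemG i').2 hi'good⟩
    obtain ⟨i₀, hi₀G, hmin⟩ := G.exists_min_image (fun i => dist (x j) (x i)) hGne
    have hi₀good : IsTwoShellGood (1 / 20) (47 / 50) 1 x i₀ := (hmemG i₀).1 hi₀G
    have hD_le : dist (x j) (x i₀) ≤ r := by
      have := hmin i' ((hmemG i').2 hi'good)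
      rw [dist_comm] at hi'd
      exact this.trans hi'd
    have hD_gt : (21 / 20 : ℝ) < dist (x j) (x i₀) := by
      by_contra hle
      push Not at hle
      exact hjT ((hmemT j).2 ⟨hjbad, i₀, hi₀good, by rw [dist_comm]; exact hle⟩)
    have hji₀ : j ≠ i₀ := fun h => hjbad (h ▸ hi₀good)
    obtain ⟨k, -, hkd, hkj⟩ := hdesc N x i₀ j hi₀good hji₀
    have hkbad : ¬ IsTwoShellGood (1 / 20) (47 / 50) 1 x k := fun hk => by
      have := hmin k ((hmemG k).2 hk)
      linarith
    refine ⟨k, (hmemT k).2 ⟨hkbad, i₀, hi₀good, ?_⟩, ?_⟩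
    · rw [dist_comm]; exact hkd
    · linarith
  have hsd : (Br.card : ℝ) ≤ ((Br \ T).card : ℝ) + (T.card : ℝ) := by
    exact_mod_cast Finset.card_le_card_sdiff_add_card (s := Br) (t := T)
  nlinarith [hfib, hsd]

/-- **The residual is radius-robust.**  For every `r ≥ 21/20`, the contact gap at radius `r`
(bad particles within `r` of a good particle pay) and the TIGHT contact gap (radius `21/20`) are
equivalent: one direction is monotonicity of the charged population, the other divides the gap
constant by `(2r/δ + 1)³ + 1` (`card_bad_near_good_le_tight`).  In particular lead 0's residual
`ContactGap` at radius `3` (`nearFarGlueR_of_contactGap`, p102346) and `stub_tightContactGap` are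
the same statement. [folklore] -/
theorem contactGapAt_iff_tightContactGap {r : ℝ} (hr : 21 / 20 ≤ r) :
    (∀ δ : ℝ, 0 < δ → ∃ g₂ : ℝ, 0 < g₂ ∧ ∀ (N : ℕ) (x : Fin N → EuclideanSpace ℝ (Fin 3)),
      (∀ i j : Fin N, i ≠ j → δ ≤ dist (x i) (x j)) →
      (N : ℝ) * (⨅ Q : PeriodicConfiguration 3, Q.energyPerParticle lennardJones)
        + g₂ * (Nat.card {j : Fin N // ¬ IsTwoShellGood (1 / 20) (47 / 50) 1 x j ∧
            ∃ i : Fin N, IsTwoShellGood (1 / 20) (47 / 50) 1 x i ∧ dist (x i) (x j) ≤ r} : ℝ)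
        ≤ interactionEnergy lennardJones x) ↔
    (∀ δ : ℝ, 0 < δ → ∃ g₂ : ℝ, 0 < g₂ ∧ ∀ (N : ℕ) (x : Fin N → EuclideanSpace ℝ (Fin 3)),
      (∀ i j : Fin N, i ≠ j → δ ≤ dist (x i) (x j)) →
      (N : ℝ) * (⨅ Q : PeriodicConfiguration 3, Q.energyPerParticle lennardJones)
        + g₂ * (Nat.card {j : Fin N // ¬ IsTwoShellGood (1 / 20) (47 / 50) 1 x j ∧
            ∃ i : Fin N, IsTwoShellGood (1 / 20) (47 / 50) 1 x i ∧ dist (x i) (x j) ≤ 21 / 20} : ℝ)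
        ≤ interactionEnergy lennardJones x) := by
  constructor
  · intro h δ hδ
    obtain ⟨g₂, hg₂, hall⟩ := h δ hδ
    refine ⟨g₂, hg₂, fun N x hsep => ?_⟩
    have hmono : (Nat.card {j : Fin N // ¬ IsTwoShellGood (1 / 20) (47 / 50) 1 x j ∧
        ∃ i : Fin N, IsTwoShellGood (1 / 20) (47 / 50) 1 x i ∧ dist (x i) (x j) ≤ 21 / 20} : ℝ) ≤
        (Nat.card {j : Fin N // ¬ IsTwoShellGood (1 / 20) (47 / 50) 1 x j ∧
          ∃ i : Fin N, IsTwoShellGood (1 / 20) (47 / 50) 1 x i ∧ dist (x i) (x j) ≤ r} : ℝ) := by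
      exact_mod_cast Nat.card_le_card_of_injective
        (fun a : {j : Fin N // ¬ IsTwoShellGood (1 / 20) (47 / 50) 1 x j ∧
            ∃ i : Fin N, IsTwoShellGood (1 / 20) (47 / 50) 1 x i ∧ dist (x i) (x j) ≤ 21 / 20} =>
          (⟨a.1, a.2.1, by obtain ⟨i, hi, hd⟩ := a.2.2; exact ⟨i, hi, hd.trans hr⟩⟩ :
            {j : Fin N // ¬ IsTwoShellGood (1 / 20) (47 / 50) 1 x j ∧
              ∃ i : Fin N, IsTwoShellGood (1 / 20) (47 / 50) 1 x i ∧ dist (x i) (x j) ≤ r}))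
        (fun a b hab => Subtype.ext (by simpa using congrArg Subtype.val hab))
    have := hall N x hsep
    nlinarith [mul_le_mul_of_nonneg_left hmono hg₂.le]
  · intro h δ hδ
    obtain ⟨g₂, hg₂, hall⟩ := h δ hδ
    have hK : 0 < (2 * r / δ + 1) ^ 3 + 1 := by
      have : 0 ≤ 2 * r / δ := by positivity
      positivity
    refine ⟨g₂ / ((2 * r / δ + 1) ^ 3 + 1), div_pos hg₂ hK, fun N x hsep => ?_⟩
    have hcount := card_bad_near_good_le_tight hδ hr x hsep
    have hE := hall N x hsep
    have key : g₂ / ((2 * r / δ + 1) ^ 3 + 1) *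
        (Nat.card {j : Fin N // ¬ IsTwoShellGood (1 / 20) (47 / 50) 1 x j ∧
          ∃ i : Fin N, IsTwoShellGood (1 / 20) (47 / 50) 1 x i ∧ dist (x i) (x j) ≤ r} : ℝ) ≤
        g₂ * (Nat.card {j : Fin N // ¬ IsTwoShellGood (1 / 20) (47 / 50) 1 x j ∧
          ∃ i : Fin N, IsTwoShellGood (1 / 20) (47 / 50) 1 x i ∧ dist (x i) (x j) ≤ 21 / 20} : ℝ) := by
      rw [div_mul_eq_mul_div, div_le_iff₀ hK]
      have := mul_le_mul_of_nonneg_left hcount hg₂.le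
      nlinarith [this]
    linarith

/-- **Registered sub-goal `stub_radiusRobust` of the crux item** (line `Sketch`, continuation lead
c1): for every contact radius `r ≥ 21/20` the contact gap at radius `r` is equivalent to the tight
contact gap — `contactGapAt_iff_tightContactGap` quantified over `r`. [folklore] -/
theorem stub_radiusRobust :
    ∀ r : ℝ, 21 / 20 ≤ r →
    ((∀ δ : ℝ, 0 < δ → ∃ g₂ : ℝ, 0 < g₂ ∧ ∀ (N : ℕ) (x : Fin N → EuclideanSpace ℝ (Fin 3)),
      (∀ i j : Fin N, i ≠ j → δ ≤ dist (x i) (x j)) →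
      (N : ℝ) * (⨅ Q : PeriodicConfiguration 3, Q.energyPerParticle lennardJones)
        + g₂ * (Nat.card {j : Fin N // ¬ IsTwoShellGood (1 / 20) (47 / 50) 1 x j ∧
            ∃ i : Fin N, IsTwoShellGood (1 / 20) (47 / 50) 1 x i ∧ dist (x i) (x j) ≤ r} : ℝ)
        ≤ interactionEnergy lennardJones x) ↔
    (∀ δ : ℝ, 0 < δ → ∃ g₂ : ℝ, 0 < g₂ ∧ ∀ (N : ℕ) (x : Fin N → EuclideanSpace ℝ (Fin 3)),
      (∀ i j : Fin N, i ≠ j → δ ≤ dist (x i) (x j)) →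
      (N : ℝ) * (⨅ Q : PeriodicConfiguration 3, Q.energyPerParticle lennardJones)
        + g₂ * (Nat.card {j : Fin N // ¬ IsTwoShellGood (1 / 20) (47 / 50) 1 x j ∧
            ∃ i : Fin N, IsTwoShellGood (1 / 20) (47 / 50) 1 x i ∧ dist (x i) (x j) ≤ 21 / 20} : ℝ)
        ≤ interactionEnergy lennardJones x)) :=
  fun _ hr => contactGapAt_iff_tightContactGap hr

end Summit.AtomisticToContinuum.Crystallization.Theorems.PhononSlackCertificatesNearFarGlueR

end
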